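import Mathlib
import Summits.Ventures.PercRepro2.StarOXhatB
import Summits.Ventures.PercRepro2.StarBXhatA
import Summits.Ventures.PercRepro2.HMFPendantO
import Summits.Ventures.PercRepro2.StarHStar

/-!
# The mean field `X̂` at the four-coin hub star `{a₁, a₂, o, b}`: the row sums, part A (blind cell
PercRepro2, night-1 g11; NIGHT1-G11.md §5; g11's StarHXhat.lean split in two by night-1 g12 under the
400-line lint — this file l.1–272 of the twin, StarHXhatB the rest)

`X̂ = Σ_W P(C(a₃) = W) · termW W`, split over the sixteen coin outcomes: with the `b`-coin open
the rows with one root carry the residual share of the free root to `o`, which the domain Markov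
property turns into the plain connection (`sum_rows_of_outc_b₄`, the pattern of
`StarOB.sum_rows_of_outc_b`); with the `b`-coin closed: the `o`-coin open kills every row
(`sum_f3_rows_zero₄`), both root coins open kill every row (`sum_f12_rows_zero₄`), only `β` open
gives the heavy row sum of class O (`sum_f2_rows₄`), only `α` the light one (`sum_f1_rows₄`),
all closed the isolated term `termW {a₃}` (`sum_cccc_rows`) — the last three in StarHXhatB.
-/

namespace Summit.Ventures.PercRepro2

open StarGlue PendantRoot

namespace StarH

section Xhat

variable {V : Type*} {E : Type*} [Fintype E] [DecidableEq E] [Fintype V] [DecidableEq V]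
  {R : Type*} [Field R] [LinearOrder R] [IsStrictOrderedRing R]

variable (p : E → R) (ends : E → Sym2 V) {f₁ f₂ f₃ f₄ : E} {a₃ a₁ a₂ o b : V}

open StarO (pOut viaStar cw prob_viaStar free_viaStar heavySum lightSum)
open StarB (cl_conn_iff cl_inter_conn_eq_del_outc termW_of_b_left termW_of_b_right termW_of_b_none
  termW_of_both)

omit [Fintype E] [DecidableEq E] [Fintype V] [DecidableEq V] [LinearOrder R] [IsStrictOrderedRing R] in
/-- With the `b`-coin open, `a₃ ↔ b`. -/
lemma conn_a3_b_of_f4 (hf₄ : ends f₄ = s(a₃, b)) {ω : Config E} (h4 : ω f₄ = true) :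
    Conn ends ω a₃ b :=
  conn_of_openAdj ⟨f₄, h4, hf₄⟩

omit [Fintype E] [DecidableEq E] [Fintype V] [DecidableEq V] [LinearOrder R] [IsStrictOrderedRing R] in
/-- The outcome event is determined by the four coins. -/
lemma dependsOn_outc₄ (f₁ f₂ f₃ f₄ : E) (b₁ b₂ b₃ b₄ : Bool) :
    DependsOn (· ∈ outc₄ f₁ f₂ f₃ f₄ b₁ b₂ b₃ b₄) ({f₁, f₂, f₃, f₄} : Set E) := by
  intro ω ω' h
  show (ω f₁ = b₁ ∧ ω f₂ = b₂ ∧ ω f₃ = b₃ ∧ ω f₄ = b₄) =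
    (ω' f₁ = b₁ ∧ ω' f₂ = b₂ ∧ ω' f₃ = b₃ ∧ ω' f₄ = b₄)
  rw [h f₁ (by simp), h f₂ (by simp), h f₃ (by simp), h f₄ (by simp)]

omit [LinearOrder R] [IsStrictOrderedRing R] in
/-- **Domain Markov row by row, with the four coins**: for `a₃ ∈ W` the coin outcome is
determined by edges touching `W`, so `{C(a₃) = W} ∩ O` is independent of the residual
connection. -/
lemma prob_cl_outc_del₄ (hf₁ : ends f₁ = s(a₃, a₁)) (hf₂ : ends f₂ = s(a₃, a₂))
    (hf₃ : ends f₃ = s(a₃, o)) (hf₄ : ends f₄ = s(a₃, b)) {W : Finset V} (h3W : a₃ ∈ W)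
    (b₁ b₂ b₃ b₄ : Bool) (x y : V) :
    prob p (clusterEvent ends a₃ (↑W : Set V) ∩ outc₄ f₁ f₂ f₃ f₄ b₁ b₂ b₃ b₄ ∩
        connDelEvent ends W x y) =
      prob p (clusterEvent ends a₃ (↑W : Set V) ∩ outc₄ f₁ f₂ f₃ f₄ b₁ b₂ b₃ b₄) *
        prob p (connDelEvent ends W x y) := by
  have hsub : ({f₁, f₂, f₃, f₄} : Set E) ⊆ touches ends (↑W : Set V) := by
    intro e he
    simp only [Set.mem_insert_iff, Set.mem_singleton_iff] at he
    rcases he with rfl | rfl | rfl | rfl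
    · exact mem_touches_of_ends hf₁ (Or.inl (Finset.mem_coe.2 h3W))
    · exact mem_touches_of_ends hf₂ (Or.inl (Finset.mem_coe.2 h3W))
    · exact mem_touches_of_ends hf₃ (Or.inl (Finset.mem_coe.2 h3W))
    · exact mem_touches_of_ends hf₄ (Or.inl (Finset.mem_coe.2 h3W))
  have hA : DependsOn (· ∈ clusterEvent ends a₃ (↑W : Set V) ∩ outc₄ f₁ f₂ f₃ f₄ b₁ b₂ b₃ b₄)
      (touches ends (↑W : Set V)) := by
    have h := dependsOn_inter (dependsOn_clusterEvent ends a₃ (↑W : Set V))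
      (dependsOn_outc₄ f₁ f₂ f₃ f₄ b₁ b₂ b₃ b₄)
    exact DependsOn.mono (Set.union_subset (subset_refl _) hsub) h
  have hB : DependsOn (· ∈ connDelEvent ends W x y) (touches ends (↑W : Set V))ᶜ :=
    dependsOn_restrict (touches ends (↑W : Set V))ᶜ (fun ω' => Conn ends ω' x y)
  exact prob_inter_eq_mul_of_dependsOn p disjoint_compl_right hA hB

omit [LinearOrder R] [IsStrictOrderedRing R] in
/-- **The row sum of an outcome with the `b`-coin open** (the pattern of
`StarOB.sum_rows_of_outc_b`): the residual shares of the free root become plain connections. -/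
theorem sum_rows_of_outc_b₄ (hf₁ : ends f₁ = s(a₃, a₁)) (hf₂ : ends f₂ = s(a₃, a₂))
    (hf₃ : ends f₃ = s(a₃, o)) (hf₄ : ends f₄ = s(a₃, b)) (b₁ b₂ b₃ : Bool) :
    ∑ W : Finset V, prob p (clusterEvent ends a₃ (↑W : Set V) ∩ outc₄ f₁ f₂ f₃ f₄ b₁ b₂ b₃ true) *
        termW p ends o a₁ a₂ b W =
      prob p (outc₄ f₁ f₂ f₃ f₄ b₁ b₂ b₃ true ∩ connEvent ends a₃ a₁ ∩ (connEvent ends a₃ a₂)ᶜ ∩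
          connEvent ends a₂ o) +
        prob p (outc₄ f₁ f₂ f₃ f₄ b₁ b₂ b₃ true ∩ connEvent ends a₃ a₂ ∩ (connEvent ends a₃ a₁)ᶜ ∩
          connEvent ends a₁ o) := by
  rw [prob_eq_sum_clusterEvent p ends a₃ (outc₄ f₁ f₂ f₃ f₄ b₁ b₂ b₃ true ∩ connEvent ends a₃ a₁ ∩
      (connEvent ends a₃ a₂)ᶜ ∩ connEvent ends a₂ o),
    prob_eq_sum_clusterEvent p ends a₃ (outc₄ f₁ f₂ f₃ f₄ b₁ b₂ b₃ true ∩ connEvent ends a₃ a₂ ∩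
      (connEvent ends a₃ a₁)ᶜ ∩ connEvent ends a₁ o), ← Finset.sum_add_distrib]
  refine Finset.sum_congr rfl fun W _ => ?_
  have hbW : ∀ ω ∈ clusterEvent ends a₃ (↑W : Set V) ∩ outc₄ f₁ f₂ f₃ f₄ b₁ b₂ b₃ true, b ∈ W := by
    rintro ω ⟨hω, hO⟩
    exact (cl_conn_iff ends hω b).1 (conn_a3_b_of_f4 ends hf₄ (mem_outc₄.1 hO).2.2.2)
  by_cases h3W : a₃ ∈ W
  · by_cases hb : b ∈ W
    · by_cases h1 : a₁ ∈ W
      · by_cases h2 : a₂ ∈ W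
        · rw [termW_of_both p ends h1 h2, mul_zero]
          have e1 : clusterEvent ends a₃ (↑W : Set V) ∩ (outc₄ f₁ f₂ f₃ f₄ b₁ b₂ b₃ true ∩
              connEvent ends a₃ a₁ ∩ (connEvent ends a₃ a₂)ᶜ ∩ connEvent ends a₂ o) = ∅ := by
            ext ω
            simp only [Set.mem_inter_iff, Set.mem_compl_iff, mem_connEvent,
              Set.mem_empty_iff_false, iff_false]
            rintro ⟨hω, ⟨⟨_, _⟩, hn⟩, _⟩
            exact hn ((cl_conn_iff ends hω a₂).2 h2)
          have e2 : clusterEvent ends a₃ (↑W : Set V) ∩ (outc₄ f₁ f₂ f₃ f₄ b₁ b₂ b₃ true ∩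
              connEvent ends a₃ a₂ ∩ (connEvent ends a₃ a₁)ᶜ ∩ connEvent ends a₁ o) = ∅ := by
            ext ω
            simp only [Set.mem_inter_iff, Set.mem_compl_iff, mem_connEvent,
              Set.mem_empty_iff_false, iff_false]
            rintro ⟨hω, ⟨⟨_, _⟩, hn⟩, _⟩
            exact hn ((cl_conn_iff ends hω a₁).2 h1)
          rw [e1, e2, prob_empty, add_zero]
        · rw [termW_of_b_left p ends h1 h2 hb]
          have e2 : clusterEvent ends a₃ (↑W : Set V) ∩ (outc₄ f₁ f₂ f₃ f₄ b₁ b₂ b₃ true ∩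
              connEvent ends a₃ a₂ ∩ (connEvent ends a₃ a₁)ᶜ ∩ connEvent ends a₁ o) = ∅ := by
            ext ω
            simp only [Set.mem_inter_iff, Set.mem_compl_iff, mem_connEvent,
              Set.mem_empty_iff_false, iff_false]
            rintro ⟨hω, ⟨⟨_, h⟩, _⟩, _⟩
            exact h2 ((cl_conn_iff ends hω a₂).1 h)
          rw [e2, prob_empty, add_zero]
          have e1 : clusterEvent ends a₃ (↑W : Set V) ∩ (outc₄ f₁ f₂ f₃ f₄ b₁ b₂ b₃ true ∩
              connEvent ends a₃ a₁ ∩ (connEvent ends a₃ a₂)ᶜ ∩ connEvent ends a₂ o) =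
              clusterEvent ends a₃ (↑W : Set V) ∩ outc₄ f₁ f₂ f₃ f₄ b₁ b₂ b₃ true ∩
                connEvent ends a₂ o := by
            ext ω
            simp only [Set.mem_inter_iff, Set.mem_compl_iff, mem_connEvent]
            constructor
            · rintro ⟨hω, ⟨⟨⟨hO, _⟩, _⟩, h⟩⟩; exact ⟨⟨hω, hO⟩, h⟩
            · rintro ⟨⟨hω, hO⟩, h⟩
              exact ⟨hω, ⟨⟨⟨hO, (cl_conn_iff ends hω a₁).2 h1⟩,
                fun h' => h2 ((cl_conn_iff ends hω a₂).1 h')⟩, h⟩⟩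
          rw [e1]
          by_cases hoW : o ∈ W
          · have hd : delConnProb p ends W a₂ o = 0 := by simp [delConnProb, hoW]
            have e0 : clusterEvent ends a₃ (↑W : Set V) ∩ outc₄ f₁ f₂ f₃ f₄ b₁ b₂ b₃ true ∩
                connEvent ends a₂ o = ∅ := by
              ext ω
              simp only [Set.mem_inter_iff, mem_connEvent, Set.mem_empty_iff_false, iff_false]
              rintro ⟨⟨hω, _⟩, h⟩
              exact h2 ((cl_conn_iff ends hω a₂).1
                (conn_trans ((cl_conn_iff ends hω o).2 hoW) (conn_symm h)))
            rw [hd, mul_zero, e0, prob_empty]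
          · have hd : delConnProb p ends W a₂ o = prob p (connDelEvent ends W a₂ o) := by
              simp [delConnProb, hoW]
            rw [hd, cl_inter_conn_eq_del_outc ends h2 _, prob_cl_outc_del₄ p ends hf₁ hf₂ hf₃ hf₄ h3W]
      · by_cases h2 : a₂ ∈ W
        · rw [termW_of_b_right p ends h1 h2 hb]
          have e1 : clusterEvent ends a₃ (↑W : Set V) ∩ (outc₄ f₁ f₂ f₃ f₄ b₁ b₂ b₃ true ∩
              connEvent ends a₃ a₁ ∩ (connEvent ends a₃ a₂)ᶜ ∩ connEvent ends a₂ o) = ∅ := by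
            ext ω
            simp only [Set.mem_inter_iff, Set.mem_compl_iff, mem_connEvent,
              Set.mem_empty_iff_false, iff_false]
            rintro ⟨hω, ⟨⟨_, h⟩, _⟩, _⟩
            exact h1 ((cl_conn_iff ends hω a₁).1 h)
          rw [e1, prob_empty, zero_add]
          have e2 : clusterEvent ends a₃ (↑W : Set V) ∩ (outc₄ f₁ f₂ f₃ f₄ b₁ b₂ b₃ true ∩
              connEvent ends a₃ a₂ ∩ (connEvent ends a₃ a₁)ᶜ ∩ connEvent ends a₁ o) =
              clusterEvent ends a₃ (↑W : Set V) ∩ outc₄ f₁ f₂ f₃ f₄ b₁ b₂ b₃ true ∩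
                connEvent ends a₁ o := by
            ext ω
            simp only [Set.mem_inter_iff, Set.mem_compl_iff, mem_connEvent]
            constructor
            · rintro ⟨hω, ⟨⟨⟨hO, _⟩, _⟩, h⟩⟩; exact ⟨⟨hω, hO⟩, h⟩
            · rintro ⟨⟨hω, hO⟩, h⟩
              exact ⟨hω, ⟨⟨⟨hO, (cl_conn_iff ends hω a₂).2 h2⟩,
                fun h' => h1 ((cl_conn_iff ends hω a₁).1 h')⟩, h⟩⟩
          rw [e2]
          by_cases hoW : o ∈ W
          · have hd : delConnProb p ends W a₁ o = 0 := by simp [delConnProb, hoW]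
            have e0 : clusterEvent ends a₃ (↑W : Set V) ∩ outc₄ f₁ f₂ f₃ f₄ b₁ b₂ b₃ true ∩
                connEvent ends a₁ o = ∅ := by
              ext ω
              simp only [Set.mem_inter_iff, mem_connEvent, Set.mem_empty_iff_false, iff_false]
              rintro ⟨⟨hω, _⟩, h⟩
              exact h1 ((cl_conn_iff ends hω a₁).1
                (conn_trans ((cl_conn_iff ends hω o).2 hoW) (conn_symm h)))
            rw [hd, mul_zero, e0, prob_empty]
          · have hd : delConnProb p ends W a₁ o = prob p (connDelEvent ends W a₁ o) := by
              simp [delConnProb, hoW]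
            rw [hd, cl_inter_conn_eq_del_outc ends h1 _, prob_cl_outc_del₄ p ends hf₁ hf₂ hf₃ hf₄ h3W]
        · rw [termW_of_b_none p ends h1 h2 hb, mul_zero]
          have e1 : clusterEvent ends a₃ (↑W : Set V) ∩ (outc₄ f₁ f₂ f₃ f₄ b₁ b₂ b₃ true ∩
              connEvent ends a₃ a₁ ∩ (connEvent ends a₃ a₂)ᶜ ∩ connEvent ends a₂ o) = ∅ := by
            ext ω
            simp only [Set.mem_inter_iff, Set.mem_compl_iff, mem_connEvent,
              Set.mem_empty_iff_false, iff_false]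
            rintro ⟨hω, ⟨⟨_, h⟩, _⟩, _⟩
            exact h1 ((cl_conn_iff ends hω a₁).1 h)
          have e2 : clusterEvent ends a₃ (↑W : Set V) ∩ (outc₄ f₁ f₂ f₃ f₄ b₁ b₂ b₃ true ∩
              connEvent ends a₃ a₂ ∩ (connEvent ends a₃ a₁)ᶜ ∩ connEvent ends a₁ o) = ∅ := by
            ext ω
            simp only [Set.mem_inter_iff, Set.mem_compl_iff, mem_connEvent,
              Set.mem_empty_iff_false, iff_false]
            rintro ⟨hω, ⟨⟨_, h⟩, _⟩, _⟩
            exact h2 ((cl_conn_iff ends hω a₂).1 h)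
          rw [e1, e2, prob_empty, add_zero]
    · have e0 : clusterEvent ends a₃ (↑W : Set V) ∩ outc₄ f₁ f₂ f₃ f₄ b₁ b₂ b₃ true = ∅ := by
        ext ω
        simp only [Set.mem_empty_iff_false, iff_false]
        intro h
        exact hb (hbW ω h)
      have e1 : clusterEvent ends a₃ (↑W : Set V) ∩ (outc₄ f₁ f₂ f₃ f₄ b₁ b₂ b₃ true ∩
          connEvent ends a₃ a₁ ∩ (connEvent ends a₃ a₂)ᶜ ∩ connEvent ends a₂ o) = ∅ := by
        rw [← Set.subset_empty_iff, ← e0]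
        rintro ω ⟨hω, ⟨⟨⟨hO, _⟩, _⟩, _⟩⟩; exact ⟨hω, hO⟩
      have e2 : clusterEvent ends a₃ (↑W : Set V) ∩ (outc₄ f₁ f₂ f₃ f₄ b₁ b₂ b₃ true ∩
          connEvent ends a₃ a₂ ∩ (connEvent ends a₃ a₁)ᶜ ∩ connEvent ends a₁ o) = ∅ := by
        rw [← Set.subset_empty_iff, ← e0]
        rintro ω ⟨hω, ⟨⟨⟨hO, _⟩, _⟩, _⟩⟩; exact ⟨hω, hO⟩
      rw [e0, e1, e2, prob_empty, zero_mul, add_zero]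
  · have e0 : clusterEvent ends a₃ (↑W : Set V) = ∅ := by
      ext ω
      simp only [mem_clusterEvent, Set.mem_empty_iff_false, iff_false]
      intro hW
      exact h3W (Finset.mem_coe.1 (hW ▸ mem_cluster_self ends ω a₃))
    rw [e0, Set.empty_inter, Set.empty_inter, Set.empty_inter, prob_empty, zero_mul, add_zero]

omit [Fintype E] [DecidableEq E] [Fintype V] [DecidableEq V] [LinearOrder R] [IsStrictOrderedRing R] in
/-- With the `o`-coin open, `o` lies in the cluster of `a₃`: rows avoiding `o` are empty. -/
lemma clusterEvent_a3_inter_outc_f3₄ (hf₃ : ends f₃ = s(a₃, o)) {W : Finset V} (hoW : o ∉ W)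
    (b₁ b₂ b₄ : Bool) :
    clusterEvent ends a₃ (↑W : Set V) ∩ outc₄ f₁ f₂ f₃ f₄ b₁ b₂ true b₄ = ∅ := by
  ext ω
  simp only [Set.mem_inter_iff, mem_clusterEvent, mem_outc₄, Set.mem_empty_iff_false, iff_false,
    not_and]
  intro hW _ _ h3 _
  apply hoW
  have : o ∈ cluster ends ω a₃ := conn_of_openAdj ⟨f₃, h3, hf₃⟩
  rw [hW] at this
  exact Finset.mem_coe.1 this

omit [LinearOrder R] [IsStrictOrderedRing R] in
/-- Rows with the `o`-coin open carry no mean-field weight. -/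
lemma sum_f3_rows_zero₄ (hf₃ : ends f₃ = s(a₃, o)) (b₁ b₂ b₄ : Bool) :
    ∑ W : Finset V, prob p (clusterEvent ends a₃ (↑W : Set V) ∩ outc₄ f₁ f₂ f₃ f₄ b₁ b₂ true b₄) *
        termW p ends o a₁ a₂ b W = 0 := by
  refine Finset.sum_eq_zero fun W _ => ?_
  by_cases hoW : o ∈ W
  · rw [HMFPendantO.termW_eq_zero_of_mem p ends hoW, mul_zero]
  · rw [clusterEvent_a3_inter_outc_f3₄ ends hf₃ hoW, prob_empty, zero_mul]

omit [Fintype E] [DecidableEq E] [Fintype V] [DecidableEq V] [LinearOrder R] [IsStrictOrderedRing R] in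
/-- With both root coins open, both roots lie in the cluster of `a₃`. -/
lemma clusterEvent_a3_inter_outc_f12₄ (hf₁ : ends f₁ = s(a₃, a₁)) (hf₂ : ends f₂ = s(a₃, a₂))
    {W : Finset V} (h : ¬ (a₁ ∈ W ∧ a₂ ∈ W)) (b₃ b₄ : Bool) :
    clusterEvent ends a₃ (↑W : Set V) ∩ outc₄ f₁ f₂ f₃ f₄ true true b₃ b₄ = ∅ := by
  ext ω
  simp only [Set.mem_inter_iff, mem_clusterEvent, mem_outc₄, Set.mem_empty_iff_false, iff_false,
    not_and]
  intro hW h1 h2 _ _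
  apply h
  have e1 : a₁ ∈ cluster ends ω a₃ := conn_of_openAdj ⟨f₁, h1, hf₁⟩
  have e2 : a₂ ∈ cluster ends ω a₃ := conn_of_openAdj ⟨f₂, h2, hf₂⟩
  rw [hW] at e1 e2
  exact ⟨Finset.mem_coe.1 e1, Finset.mem_coe.1 e2⟩

omit [LinearOrder R] [IsStrictOrderedRing R] in
/-- Rows with both root coins open carry no mean-field weight. -/
lemma sum_f12_rows_zero₄ (hf₁ : ends f₁ = s(a₃, a₁)) (hf₂ : ends f₂ = s(a₃, a₂)) (b₃ b₄ : Bool) :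
    ∑ W : Finset V, prob p (clusterEvent ends a₃ (↑W : Set V) ∩ outc₄ f₁ f₂ f₃ f₄ true true b₃ b₄) *
        termW p ends o a₁ a₂ b W = 0 := by
  refine Finset.sum_eq_zero fun W _ => ?_
  by_cases h : a₁ ∈ W ∧ a₂ ∈ W
  · simp [termW, h.1, h.2]
  · rw [clusterEvent_a3_inter_outc_f12₄ ends hf₁ hf₂ h, prob_empty, zero_mul]

end Xhat

end StarH

end Summit.Ventures.PercRepro2
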